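import Literature.NumberTheory.Rogawski1990.ArchExplicitTransferFactorCurveSmooth   -- ★ p05: the place factors `F_w(z) = μ_∞(ι_w z)`: `archHeckeValue_single_mul`, `…_single_ne_zero`, `continuousAt_archHeckeValue_single`
import Literature.NumberTheory.Automorphic.QuadraticHeckeCharacterCM               -- ★ `quadraticHeckeCharCM_infiniteIdeleSingle` (the archimedean type of `ω_{L∕L⁺}` is `sgn`), `infiniteIdeleSingle`
import Literature.NumberTheory.Automorphic.ArchExpIdeleGLOne                       -- ★ `idele_eq_of_snd_eq_of_extensionEmbedding_eq`, `extensionEmbedding_ideleBaseChange_fst_apply`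
import Literature.Analysis.SpecialFunctions.ContinuousMultiplicativeCharacterShape -- ★ LH3-p04 (g2): `exists_odd_eq_zpow_of_map_mul_complex_of_forall_pos_of_neg_one`
import HarnessLib

/-!
# The μ-GUARD at infinity: under `μ|_{𝔸_{L⁺}^×} = ω_{L∕L⁺}` every place factor of `μ_∞` is `F_w(z) = (z∕|z|)^{m_w}` with `m_w` ODD — Rogawski's «`μ⁻¹(z) = z|z|⁻¹(z∕z̄)^t`»
# (Rogawski 1990 §4.9 p. 55, §8.2 p. 119; Tate's thesis §2.3)

Topic `NumberTheory/Rogawski1990`; namespace `Literature.NumberTheory.Rogawski1990`.  THEOREMS ONLY (no `def`, no instance, no notation, no axiom, no named fact, no `sorry`).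
Cell `pub/hodgecm-mathlib`, line LH3 (closer stub `stub_N9`, crux H413 = `stmt-HodgeConjecture-24833`), brick **(μ-guard-∞)** of the (D-i-def) chain (LH3-plan (g2) DEALER WORDS #3;
LH3-p04 (g2) census, 2026-09-02): the leaf's guard `hμω : ∀ x, μ (ideleBaseChange L⁺ L x) = quadraticHeckeCharCM L x` (= print's «`μ` a character of `I_E∕E^*` whose restriction to `I_F` is
`ω_{E∕F}`», §4.9 p. 55) READ AT THE INFINITE PLACES.  Consumer: (Δ-def-explicit) — at a totally definite frame `Δ″_∞ = τ·D_{G∕H,∞}·Π κ_w` along the torus family is the smooth function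
`μ_∞(γ₂)·Π_w A_w ū_w^{k_w+1}` exactly because `F_w(A)⁻¹·|A| = A·ū^{k+1}` for `F_w = (z∕|z|)^{2k+1}` (census (D-i-def) (2)); without the guard `μ_w(A)⁻¹|A|` is not `C¹` across `A = 0`.

THE MATHEMATICS.  `L` CM, `L⁺` its maximal totally real subfield, `w` a (complex) place of `L` above the real place `v` of `L⁺` (unique: Mathlib `IsCMField.equivInfinitePlace`), `r ∈ ℝ^×`.
The idèle `((r)_v)_L` (base change of the idèle of `L⁺` that is `r` at `v` and `1` elsewhere) IS the idèle of `L` that is `r` at `w` and `1` elsewhere — in the tree's two spellings: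
`ideleBaseChange L⁺ L (infiniteIdeleSingle v c)` (`c ↔ r` under `L⁺_v ≅ ℝ`) `=` the infinite idèle read by ★ `archHeckeValue` at `(1, δ_w r) ∈ L ⊗ ℝ` (§1, by ★
`idele_eq_of_snd_eq_of_extensionEmbedding_eq`: finite parts `1`, archimedean components compared in `ℂ` through ★ `extensionEmbedding_ideleBaseChange_fst_apply` and Mathlib
`InfiniteAdeleRing.ringEquiv_mixedSpace_apply`).  Hence `F_w(r) = μ(((r)_v)_L) = ω((r)_v) = sgn r` (★ `quadraticHeckeCharCM_infiniteIdeleSingle`), i.e. `F_w` is trivial on `ℝ_{>0}` with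
`F_w(−1) = −1`, and ★ `exists_odd_eq_zpow_of_map_mul_complex_of_forall_pos_of_neg_one` (continuous multiplicative non-vanishing `F_w`, ★ p05) gives the shape.

WHAT IS PROVED.
* §1 `archHeckeValue_single_ofReal_eq_apply_ideleBaseChange` — `F_w(r) = μ(((r)_v)_L)` for real `r ≠ 0` (no guard).
* §2 **`archHeckeValue_single_ofReal_eq_sign`** — under `hμω`: `F_w(r) = if 0 < r then 1 else −1`; `…_eq_one_of_pos`, `…_neg_one`.
* §3 **`exists_odd_archHeckeValue_single_eq_zpow`** — under `hμω`: `∃ m : ℤ, Odd m ∧ ∀ z ≠ 0, F_w z = (z ∕ ‖z‖)^m` — Rogawski's «`μ⁻¹(z) = z|z|⁻¹(z∕z̄)^t`» (`m = −(2t+1)`).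
HONEST LABEL: HC_CM is proved only modulo the 7 printed citations (2 remaining: hLiu418 = stmt-HodgeConjecture-24832, h413 = stmt-HodgeConjecture-24833) until rung 0 closes; this file
is bookkeeping on the leaf's μ-guard and pays nothing by itself.

## References
* [Rogawski1990] J. D. Rogawski, *Automorphic Representations of Unitary Groups in Three Variables*, Ann. of Math. Stud. 123 (1990), §4.9 p. 55 (`μ|_{I_F} = ω_{E∕F}`), §8.2 p. 119
  («for some integer `t`, `μ⁻¹(z) = z|z|⁻¹(z∕z̄)^t`»).
* [TateThesis1967] J. Tate, *Fourier analysis in number fields and Hecke's zeta-functions*, §2.3.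
* [Omeara1963] O. T. O'Meara, *Introduction to Quadratic Forms* (1963), §71D (the archimedean type of the quadratic character).
-/

set_option autoImplicit false

noncomputable section

open NumberField NumberField.InfinitePlace NumberField.InfinitePlace.Completion Complex
open Literature.NumberTheory.GaloisRepresentations Literature.NumberTheory.Automorphic
open scoped ComplexConjugate

namespace Literature.NumberTheory.Rogawski1990

section RealPlaces

variable (L : Type) [Field L] [NumberField L] [IsCMField L] (μ : HeckeCharacter L) (w : {w : InfinitePlace L // IsComplex w})

/-! ## §1 The idèle `((r)_v)_L` is the idèle read by `μ_∞` at `(1, δ_w r)` -/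

open scoped Classical in
/-- **`F_w(r) = μ(((r)_v)_L)` for real `r ≠ 0`**: with `v = w|_{L⁺}` and `c ∈ L⁺_vˣ` the unit corresponding to `r` under `L⁺_v ≅ ℝ`, the base change to `L` of the idèle `(r)_v` of `L⁺`
is the infinite idèle of `L` that is `r` at `w` and `1` at the other places — the one ★ `archHeckeValue` evaluates `μ` on at `(1, δ_w r)`.  (Finite parts are `1`; archimedean
components agree in `ℂ`: over the REAL place `v` both Mathlib branches of ★ `extensionEmbedding_ideleBaseChange_fst_apply` give the real number `r`, and `w` is the only place of `L`
above `v`, Mathlib `IsCMField.equivInfinitePlace`.) [cite: Rogawski1990, §4.9 p. 55] [cite: TateThesis1967, §2.3] -/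
theorem archHeckeValue_single_ofReal_eq_apply_ideleBaseChange {r : ℝ} (hr : r ≠ 0) :
    archHeckeValue L μ (((fun _ => 1, Pi.mulSingle w (r : ℂ)) : mixedEmbedding.mixedSpace L)) =
      ((μ (AdeleRing.ideleBaseChange (↥(maximalRealSubfield L)) L
        (infiniteIdeleSingle (w.1.comap (algebraMap (↥(maximalRealSubfield L)) L))
          (Units.mk0 ((ringEquivRealOfIsReal (IsTotallyReal.isReal (w.1.comap (algebraMap (↥(maximalRealSubfield L)) L)))).symm r)
            (by rw [ne_eq, EmbeddingLike.map_eq_zero_iff]; exact hr)))) : ℂˣ) : ℂ) := by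
  set v : InfinitePlace ↥(maximalRealSubfield L) := w.1.comap (algebraMap (↥(maximalRealSubfield L)) L) with hvdef
  have hv : v.IsReal := IsTotallyReal.isReal v
  set c : (v.Completion)ˣ := Units.mk0 ((ringEquivRealOfIsReal hv).symm r) (by rw [ne_eq, EmbeddingLike.map_eq_zero_iff]; exact hr) with hcdef
  -- the unit `(1, δ_w r)` of `L ⊗ ℝ`
  have hu : IsUnit (((fun _ => 1, Pi.mulSingle w (r : ℂ)) : mixedEmbedding.mixedSpace L)) := by
    refine Prod.isUnit_iff.2 ⟨isUnit_one, Pi.isUnit_iff.2 fun w' => ?_⟩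
    change IsUnit ((Pi.mulSingle w (r : ℂ) : {w : InfinitePlace L // IsComplex w} → ℂ) w')
    by_cases h : w' = w
    · subst h; rw [Pi.mulSingle_eq_same]; exact isUnit_iff_ne_zero.2 (Complex.ofReal_ne_zero.2 hr)
    · rw [Pi.mulSingle_eq_of_ne h]; exact isUnit_one
  rw [archHeckeValue, dif_pos hu]
  -- the value of `extensionEmbedding v` at `c` is the real number `r`
  have hc : Completion.extensionEmbedding v (c : v.Completion) = (r : ℂ) := by
    rw [← extensionEmbeddingOfIsReal_apply hv, ← ringEquivRealOfIsReal_apply hv, hcdef, Units.val_mk0, RingEquiv.apply_symm_apply]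
  -- the two idèles coincide
  have key : infiniteIdeles L (Units.map ((InfiniteAdeleRing.ringEquiv_mixedSpace L).symm : mixedEmbedding.mixedSpace L ≃+* InfiniteAdeleRing L).toMonoidHom hu.unit) =
      AdeleRing.ideleBaseChange (↥(maximalRealSubfield L)) L (infiniteIdeleSingle v c) := by
    refine idele_eq_of_snd_eq_of_extensionEmbedding_eq L ?_ fun w' => ?_
    · rw [AdeleRing.coe_ideleBaseChange, AdeleRing.baseChange_snd, infiniteIdeleSingle_snd, map_one]
      rfl
    · -- left: the `w′`-component of `e⁻¹(1, δ_w r)` read in `ℂ` is `(1, δ_w r).2 w′`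
      have hw' : w'.IsComplex := IsTotallyComplex.isComplex w'
      have hleft : Completion.extensionEmbedding w' (((infiniteIdeles L (Units.map ((InfiniteAdeleRing.ringEquiv_mixedSpace L).symm :
          mixedEmbedding.mixedSpace L ≃+* InfiniteAdeleRing L).toMonoidHom hu.unit) : ideleGroup L) : AdeleRing (𝓞 L) L).1 w') =
          (Pi.mulSingle w (r : ℂ) : {w : InfinitePlace L // IsComplex w} → ℂ) ⟨w', hw'⟩ := by
        have happ := InfiniteAdeleRing.ringEquiv_mixedSpace_apply L ((InfiniteAdeleRing.ringEquiv_mixedSpace L).symm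
          (((fun _ => 1, Pi.mulSingle w (r : ℂ)) : mixedEmbedding.mixedSpace L)))
        rw [RingEquiv.apply_symm_apply] at happ
        have h2 := congrArg Prod.snd happ
        have h3 := congr_fun h2 ⟨w', hw'⟩
        exact h3.symm
      rw [hleft, extensionEmbedding_ideleBaseChange_fst_apply]
      by_cases hww : w' = w.1
      · -- at `w`: both branches give `r`
        subst hww
        have hsame : ((infiniteIdeleSingle v c : ideleGroup ↥(maximalRealSubfield L)) : AdeleRing (𝓞 ↥(maximalRealSubfield L)) ↥(maximalRealSubfield L)).1
            (w.1.comap (algebraMap (↥(maximalRealSubfield L)) L)) = c := infiniteIdeleSingle_fst_self v c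
        have hc' : Completion.extensionEmbedding (w.1.comap (algebraMap (↥(maximalRealSubfield L)) L)) (c : v.Completion) = (r : ℂ) := hc
        rw [hsame, hc', Complex.conj_ofReal, ite_self]
        have : (⟨w.1, hw'⟩ : {w : InfinitePlace L // IsComplex w}) = w := Subtype.ext rfl
        rw [this, Pi.mulSingle_eq_same]
      · -- off `w`: the place below differs (`w` is the only place above `v`), both sides are `1`
        have hvne : w'.comap (algebraMap (↥(maximalRealSubfield L)) L) ≠ v := fun h =>
          hww ((IsCMField.equivInfinitePlace L).injective (h.trans hvdef))
        rw [infiniteIdeleSingle_fst_of_ne c hvne, map_one, map_one, ite_self]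
        have : (⟨w', hw'⟩ : {w : InfinitePlace L // IsComplex w}) ≠ w := fun h => hww (congrArg Subtype.val h)
        rw [Pi.mulSingle_eq_of_ne this]
  rw [key]

/-! ## §2 Under the μ-guard: `F_w|_{ℝ^×} = sgn` -/

variable (hμω : ∀ x : ideleGroup ↥(maximalRealSubfield L),
  μ (AdeleRing.ideleBaseChange (↥(maximalRealSubfield L)) L x) = quadraticHeckeCharCM L x)

include hμω in
open scoped Classical in
/-- **`F_w(r) = sgn r` UNDER THE μ-GUARD** `μ|_{𝔸_{L⁺}^×} = ω_{L∕L⁺}`: `F_w(r) = μ(((r)_v)_L) = ω((r)_v) = sgn r` (§1 + ★ `quadraticHeckeCharCM_infiniteIdeleSingle`).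
[cite: Rogawski1990, §4.9 p. 55] [cite: Omeara1963, §71D proof of Thm. 71:19] -/
theorem archHeckeValue_single_ofReal_eq_sign {r : ℝ} (hr : r ≠ 0) :
    archHeckeValue L μ (((fun _ => 1, Pi.mulSingle w (r : ℂ)) : mixedEmbedding.mixedSpace L)) = if 0 < r then 1 else -1 := by
  rw [archHeckeValue_single_ofReal_eq_apply_ideleBaseChange L μ w hr, hμω, quadraticHeckeCharCM_infiniteIdeleSingle]
  simp only [Units.val_mk0, RingEquiv.apply_symm_apply]

include hμω in
open scoped Classical in
/-- `F_w(r) = 1` for `r > 0` under the μ-guard. [cite: Rogawski1990, §4.9 p. 55] -/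
theorem archHeckeValue_single_ofReal_eq_one_of_pos {r : ℝ} (hr : 0 < r) :
    archHeckeValue L μ (((fun _ => 1, Pi.mulSingle w (r : ℂ)) : mixedEmbedding.mixedSpace L)) = 1 := by
  rw [archHeckeValue_single_ofReal_eq_sign L μ w hμω hr.ne', if_pos hr]

include hμω in
open scoped Classical in
/-- `F_w(−1) = −1` under the μ-guard (the real place below `w` ramifies in `L∕L⁺`). [cite: Rogawski1990, §4.9 p. 55] [cite: Omeara1963, §71D proof of Thm. 71:19] -/
theorem archHeckeValue_single_neg_one :
    archHeckeValue L μ (((fun _ => 1, Pi.mulSingle w (-1 : ℂ)) : mixedEmbedding.mixedSpace L)) = -1 := by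
  have h := archHeckeValue_single_ofReal_eq_sign L μ w hμω (show (-1 : ℝ) ≠ 0 by norm_num)
  rw [Complex.ofReal_neg, Complex.ofReal_one, if_neg (by norm_num)] at h
  exact h

/-! ## §3 Rogawski's shape `F_w(z) = (z∕|z|)^m`, `m` odd -/

include hμω in
open scoped Classical in
/-- **ROGAWSKI'S SHAPE OF `μ_∞` UNDER THE μ-GUARD**: at every complex place `w` there is an ODD integer `m_w` with `μ_∞(ι_w z) = (z∕‖z‖)^{m_w}` for all `z ≠ 0` («for some integer `t`,
`μ⁻¹(z) = z|z|⁻¹(z∕z̄)^t`», `m = −(2t+1)`) — §2 + ★ `exists_odd_eq_zpow_of_map_mul_complex_of_forall_pos_of_neg_one` (the place factor is continuous, multiplicative and non-vanishing on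
`ℂˣ`, ★ p05). [cite: Rogawski1990, §8.2 p. 119] [cite: TateThesis1967, §2.3] -/
theorem exists_odd_archHeckeValue_single_eq_zpow :
    ∃ m : ℤ, Odd m ∧ ∀ z : ℂ, z ≠ 0 →
      archHeckeValue L μ (((fun _ => 1, Pi.mulSingle w z) : mixedEmbedding.mixedSpace L)) = (z / (‖z‖ : ℂ)) ^ m :=
  Literature.Analysis.SpecialFunctions.exists_odd_eq_zpow_of_map_mul_complex_of_forall_pos_of_neg_one
    (fun _ _ hz hz' => archHeckeValue_single_mul L μ w hz hz') (fun _ hz => continuousAt_archHeckeValue_single L μ w hz)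
    (fun _ hz => archHeckeValue_single_ne_zero L μ w hz) (fun _ hr => archHeckeValue_single_ofReal_eq_one_of_pos L μ w hμω hr)
    (archHeckeValue_single_neg_one L μ w hμω)

end RealPlaces

end Literature.NumberTheory.Rogawski1990

end
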